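import Summits.KontsevichZagierPeriods.KontsevichZagierPeriods.Theorems.SoloInformedAlgLowerChart
import HarnessLib

/-!
# The DEN-calculus over `K`: the coordinate swap

Solo programme `solo-KontsevichZagierPeriods-informed`, session s107, step (x-i) of the general
two-dimensional algorithm: the symmetry `(x₀, x₁) ↦ (x₁, x₀)` of the unit square.

* `soloInformedSwapK = rename (swap 0 1)` on `K[x₀, x₁]`, with `aeval x (swap Q) = Q(x₁, x₀)`,
  constant coefficient and support;
* **RULE SWAP** `soloInformed_presentableDenK_of_swap` — `Q` is a presentable denominator if its
  swap is (rule (2) along the monomial chart of the permutation matrix);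
* `soloInformed_presentableDenK_diagUpperK_of_swap` — the upper diagonal chart of `Q` is the swap
  of the lower diagonal chart of the swap of `Q`: presentability of `Q_up` from that of
  `(swap Q)_low`;
* `soloInformedLowSubstK U = U(v₀, v₀v₁)`, the substitution of the lower chart.

References: M. Kontsevich, D. Zagier, *Periods* (2001), §1.2 rule (2).
-/

noncomputable section

open scoped BigOperators
open MeasureTheory Set
open Literature.NumberTheory.Transcendental Literature.NumberTheory.Transcendental.KZ

namespace Summit.KontsevichZagierPeriods.KontsevichZagierPeriods.Theorems

variable {K : Type*} [Field K] [Algebra K ℝ]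

/-! ### The swap as a monomial chart -/

/-- The permutation matrix of the swap. -/
def soloInformedSwapMat : Matrix (Fin 2) (Fin 2) ℕ := !![0, 1; 1, 0]

/-- The monomial chart of the swap matrix is the swap. [this work] -/
theorem soloInformed_swapChart_eq (v : Fin 2 → ℝ) :
    (fun i => ∏ j, v j ^ soloInformedSwapMat i j) = ![v 1, v 0] := by
  funext i
  fin_cases i <;> simp [soloInformedSwapMat, Fin.prod_univ_two]

/-- `det` of the swap matrix. [this work] -/
theorem soloInformed_det_swapMat :
    (soloInformedSwapMat.map (fun t : ℕ => (t : ℝ))).det = -1 := by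
  rw [Matrix.det_fin_two]
  simp [soloInformedSwapMat]

/-- The swapped point of a point of the open square lies in the open square. -/
theorem soloInformed_swap_mem_openCube {x : Fin 2 → ℝ} (hx : x ∈ soloInformedOpenCube 2) :
    (![x 1, x 0] : Fin 2 → ℝ) ∈ soloInformedOpenCube 2 := fun j => by
  fin_cases j
  · exact hx 1
  · exact hx 0

/-- The swapped point of a point of the closed square lies in the closed square. -/
theorem soloInformed_swap_mem_cube {x : Fin 2 → ℝ} (hx : x ∈ soloInformedCube 2) :
    (![x 1, x 0] : Fin 2 → ℝ) ∈ soloInformedCube 2 := fun j => by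
  fin_cases j
  · exact hx 1
  · exact hx 0

/-- The swap chart maps the open square onto itself. [this work] -/
theorem soloInformed_image_swapChart :
    (fun (v : Fin 2 → ℝ) (i : Fin 2) => ∏ j, v j ^ soloInformedSwapMat i j) ''
      soloInformedOpenCube 2 = soloInformedOpenCube 2 := by
  ext p
  constructor
  · rintro ⟨v, hv, rfl⟩
    dsimp only
    rw [soloInformed_swapChart_eq]
    exact soloInformed_swap_mem_openCube hv
  · intro hp
    refine ⟨![p 1, p 0], soloInformed_swap_mem_openCube hp, ?_⟩
    dsimp only
    rw [soloInformed_swapChart_eq]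
    funext j
    fin_cases j <;> simp

/-! ### The swap on `K[x₀, x₁]` -/

/-- **The swap** `Q(x₀, x₁) ↦ Q(x₁, x₀)` on `K[x₀, x₁]`. [this work] -/
def soloInformedSwapK : MvPolynomial (Fin 2) K →ₐ[K] MvPolynomial (Fin 2) K :=
  MvPolynomial.rename (Equiv.swap (0 : Fin 2) 1)

/-- Values of the swapped polynomial. [this work] -/
theorem soloInformed_aeval_swapK (x : Fin 2 → ℝ) (Q : MvPolynomial (Fin 2) K) :
    (MvPolynomial.aeval x (soloInformedSwapK Q) : ℝ) = MvPolynomial.aeval ![x 1, x 0] Q := by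
  unfold soloInformedSwapK
  rw [MvPolynomial.aeval_rename]
  have h : (x ∘ (Equiv.swap (0 : Fin 2) 1)) = ![x 1, x 0] := by
    funext j
    fin_cases j
    · simp [Equiv.swap_apply_left]
    · simp [Equiv.swap_apply_right]
  rw [h]

omit [Algebra K ℝ] in
/-- The swap is an involution. [this work] -/
theorem soloInformed_swapK_swapK (Q : MvPolynomial (Fin 2) K) :
    soloInformedSwapK (soloInformedSwapK Q) = Q := by
  unfold soloInformedSwapK
  rw [MvPolynomial.rename_rename]
  have h : ((Equiv.swap (0 : Fin 2) 1) ∘ (Equiv.swap (0 : Fin 2) 1) : Fin 2 → Fin 2) = id := by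
    funext j
    simp [Equiv.swap_apply_self]
  rw [h, MvPolynomial.rename_id, AlgHom.id_apply]

omit [Algebra K ℝ] in
/-- The constant coefficient is invariant under the swap. [this work] -/
theorem soloInformed_coeff_zero_swapK (Q : MvPolynomial (Fin 2) K) :
    MvPolynomial.coeff 0 (soloInformedSwapK Q) = MvPolynomial.coeff 0 Q := by
  rw [← MvPolynomial.constantCoeff_eq, soloInformedSwapK, MvPolynomial.constantCoeff_rename]

omit [Algebra K ℝ] in
/-- The support of the swapped polynomial consists of swapped exponents. [this work] -/
theorem soloInformed_support_swapK {Q : MvPolynomial (Fin 2) K} {a : Fin 2 →₀ ℕ}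
    (ha : a ∈ (soloInformedSwapK Q).support) : ∃ b ∈ Q.support, a 0 = b 1 ∧ a 1 = b 0 := by
  classical
  have hinj : Function.Injective (Equiv.swap (0 : Fin 2) 1) := (Equiv.swap (0 : Fin 2) 1).injective
  unfold soloInformedSwapK at ha
  rw [MvPolynomial.support_rename_of_injective hinj, Finset.mem_image] at ha
  obtain ⟨b, hb, rfl⟩ := ha
  refine ⟨b, hb, ?_, ?_⟩
  · have h := Finsupp.mapDomain_apply hinj b 1
    rwa [Equiv.swap_apply_right] at h
  · have h := Finsupp.mapDomain_apply hinj b 0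
    rwa [Equiv.swap_apply_left] at h

/-! ### RULE SWAP -/

/-- **RULE SWAP.**  If `Q ≠ 0` on the open square and `Q(x₁, x₀)` is a presentable denominator,
so is `Q` (rule (2) along the swap chart). [this work] -/
theorem soloInformed_presentableDenK_of_swap
    (hK : ∀ c : K, IsAlgebraic ℚ (algebraMap K ℝ c)) {Q : MvPolynomial (Fin 2) K}
    (hQ : ∀ x ∈ soloInformedOpenCube 2, (MvPolynomial.aeval x Q : ℝ) ≠ 0)
    (h : SoloInformedPresentableDenK (soloInformedSwapK Q)) :
    SoloInformedPresentableDenK Q := by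
  refine soloInformed_presentableDenK_of_open Q fun P ρ hρ hρi => ?_
  have hdet : (soloInformedSwapMat.map (fun t : ℕ => (t : ℝ))).det ≠ 0 := by
    rw [soloInformed_det_swapMat]; norm_num
  have hQ' : ∀ v ∈ soloInformedOpenCube 2,
      (MvPolynomial.aeval v (soloInformedSwapK Q) : ℝ) ≠ 0 := fun v hv => by
    rw [soloInformed_aeval_swapK]; exact hQ _ (soloInformed_swap_mem_openCube hv)
  refine soloInformed_presentable_of_monoChartK hK soloInformedSwapMat hdet (soloInformedSwapK P)
    (soloInformedSwapK Q) hQ' ρ (by rw [soloInformed_image_swapChart, hρ]) (fun v hv => ?_)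
    fun ρ' hρ' hρ'i => h _ ρ' (by rw [hρ']) (by rw [hρ']; exact soloInformedOpenCube_subset_cube 2) hρ'i
  have hv0 : ∀ j, 0 < v j := fun j => (hv j).1
  rw [soloInformed_abs_det_monoD soloInformedSwapMat hv0, soloInformed_det_swapMat,
    soloInformed_swapChart_eq, hρi (soloInformed_swap_mem_openCube hv), soloInformed_aeval_swapK,
    soloInformed_aeval_swapK]
  have h1 : (∏ j, v j ^ (∑ i, soloInformedSwapMat i j)) = ∏ j, v j := by
    refine Finset.prod_congr rfl fun j _ => ?_
    fin_cases j <;> simp [soloInformedSwapMat, Fin.sum_univ_two]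
  rw [h1, div_self (Finset.prod_ne_zero_iff.2 fun j _ => (hv0 j).ne')]
  simp

/-! ### The upper diagonal chart through the swap -/

/-- `Q_up(v) = (swap Q)_low(v₁, v₀)` on the open square (`Q(0,0) = 0`). [this work] -/
theorem soloInformed_aeval_diagUpperK_eq_swap (Q : MvPolynomial (Fin 2) K)
    (hQ0 : MvPolynomial.coeff 0 Q = 0) {v : Fin 2 → ℝ} (hv : v ∈ soloInformedOpenCube 2) :
    (MvPolynomial.aeval v (soloInformedDiagUpperK Q) : ℝ) =
      MvPolynomial.aeval v (soloInformedSwapK (soloInformedDiagLowerK (soloInformedSwapK Q))) := by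
  have hv1 : v 1 ≠ 0 := (hv 1).1.ne'
  have hQ0' : MvPolynomial.coeff 0 (soloInformedSwapK Q) = 0 := by
    rw [soloInformed_coeff_zero_swapK]; exact hQ0
  have hup := soloInformed_aeval_upperChart_eq_mul_diagUpperK Q hQ0 v
  have hlow := soloInformed_aeval_lowerChart_eq_mul_diagLowerK (soloInformedSwapK Q) hQ0' ![v 1, v 0]
  rw [soloInformed_upperChart_eq] at hup
  rw [soloInformed_lowerChart_eq, soloInformed_aeval_swapK] at hlow
  refine mul_left_cancel₀ hv1 ?_
  rw [← hup, soloInformed_aeval_swapK]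
  have hpt : (![v 0 * v 1, v 1] : Fin 2 → ℝ) =
      ![(![v 1, v 0] : Fin 2 → ℝ) 0 * (![v 1, v 0] : Fin 2 → ℝ) 1, (![v 1, v 0] : Fin 2 → ℝ) 0] := by
    funext j
    fin_cases j <;> simp [mul_comm]
  have hpt' : (![(![v 1, v 0] : Fin 2 → ℝ) 1, (![v 1, v 0] : Fin 2 → ℝ) 0] : Fin 2 → ℝ) = v := by
    funext j
    fin_cases j <;> simp
  rw [hpt, ← hpt'] at *
  simpa using hlow

/-- **The upper chart through the swap.**  If `Q(0,0) = 0`, `Q ≠ 0` on the open square and the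
lower diagonal chart of the swap of `Q` is a presentable denominator, so is the upper diagonal
chart of `Q`. [this work] -/
theorem soloInformed_presentableDenK_diagUpperK_of_swap
    (hK : ∀ c : K, IsAlgebraic ℚ (algebraMap K ℝ c)) (Q : MvPolynomial (Fin 2) K)
    (hQ0 : MvPolynomial.coeff 0 Q = 0)
    (hQ : ∀ x ∈ soloInformedOpenCube 2, (MvPolynomial.aeval x Q : ℝ) ≠ 0)
    (h : SoloInformedPresentableDenK (soloInformedDiagLowerK (soloInformedSwapK Q))) :
    SoloInformedPresentableDenK (soloInformedDiagUpperK Q) := by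
  have hQ0' : MvPolynomial.coeff 0 (soloInformedSwapK Q) = 0 := by
    rw [soloInformed_coeff_zero_swapK]; exact hQ0
  have hQ' : ∀ v ∈ soloInformedOpenCube 2,
      (MvPolynomial.aeval v (soloInformedSwapK Q) : ℝ) ≠ 0 := fun v hv => by
    rw [soloInformed_aeval_swapK]; exact hQ _ (soloInformed_swap_mem_openCube hv)
  have hD : ∀ v ∈ soloInformedOpenCube 2, (MvPolynomial.aeval v
      (soloInformedSwapK (soloInformedDiagLowerK (soloInformedSwapK Q))) : ℝ) ≠ 0 := fun v hv => by
    rw [soloInformed_aeval_swapK]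
    exact soloInformed_aeval_diagLowerK_ne_zero _ hQ0' hQ' _ (soloInformed_swap_mem_openCube hv)
  refine soloInformed_presentableDenK_congr
    (fun v hv => (soloInformed_aeval_diagUpperK_eq_swap Q hQ0 hv).symm)
    (soloInformed_presentableDenK_of_swap hK hD ?_)
  rw [soloInformed_swapK_swapK]
  exact h

/-! ### The substitution of the lower chart -/

/-- `U ↦ U(v₀, v₀v₁)`, the substitution of the lower chart on `K[x₀, x₁]`. [this work] -/
def soloInformedLowSubstK : MvPolynomial (Fin 2) K →ₐ[K] MvPolynomial (Fin 2) K :=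
  MvPolynomial.bind₁ fun j => if j = 0 then MvPolynomial.X 0 else MvPolynomial.X 0 * MvPolynomial.X 1

/-- Values of the lower-chart substitution. [this work] -/
theorem soloInformed_aeval_lowSubstK (v : Fin 2 → ℝ) (U : MvPolynomial (Fin 2) K) :
    (MvPolynomial.aeval v (soloInformedLowSubstK U) : ℝ) = MvPolynomial.aeval ![v 0, v 0 * v 1] U := by
  unfold soloInformedLowSubstK
  rw [MvPolynomial.aeval_bind₁]
  have h : (fun j => (MvPolynomial.aeval v (if j = (0 : Fin 2) then MvPolynomial.X 0 else
      MvPolynomial.X 0 * MvPolynomial.X 1 : MvPolynomial (Fin 2) K) : ℝ)) = ![v 0, v 0 * v 1] := by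
    funext j
    fin_cases j <;> simp
  rw [h]

/-- The lower chart maps the closed square into itself. -/
theorem soloInformed_lowerChart_mem_cube {v : Fin 2 → ℝ} (hv : v ∈ soloInformedCube 2) :
    (![v 0, v 0 * v 1] : Fin 2 → ℝ) ∈ soloInformedCube 2 := fun j => by
  fin_cases j
  · exact hv 0
  · exact ⟨mul_nonneg (hv 0).1 (hv 1).1, by
      simpa using mul_le_mul (hv 0).2 (hv 1).2 (hv 1).1 zero_le_one⟩

end Summit.KontsevichZagierPeriods.KontsevichZagierPeriods.Theorems
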